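import Summits.ResolutionOfSingularities.ResolutionOfSingularities.Theorems.EquisingularLiftEquisingularLiftNatUsefulTouchNonPrincipal
import Summits.ResolutionOfSingularities.ResolutionOfSingularities.Theorems.EquisingularLiftEquisingularLiftNatK5BMYFatTouchInert
import Literature.AlgebraicGeometry.Resolution.RegularQuotientIdeal
import Literature.AlgebraicGeometry.Resolution.RegularParameterQuotient
import Literature.AlgebraicGeometry.Resolution.RegularCentreLocalCodim
import Literature.AlgebraicGeometry.Resolution.MarkedIdealsLemmas
import HarnessLib

/-!
# [OURS · L1 W4.5(b) · EL♮] T-FAT-NOT-FINISHING: at an ANISOTROPIC point, a FAT touch (relative dimension 3) is never the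
# finishing touch — the K5-BMY branch `hT` in scheme language, fact-free (any `n`; dictionary lemmas scheme ↔ stalk)
# (crux `EquisingularLiftNat` = stmt-ResolutionOfSingularities-20038; K-∀n / K5-BMY necessity lane, kill test #50)

HONEST FRAMING. OURS (cell res-hironaka, crux chain w45b, slot W4.5(b)); NOT a statement of any manuscript; replaces the role
of NOTHING in the manuscript; AI-written, AI review is weaker than expert review. Helper `--supports
stmt-ResolutionOfSingularities-20038 --as helper`.

WHAT. The ring lemma `…AnisoInertia.exists_map_span_pair_eq_span_singleton` (res-D-brk-4 p515200, res-L1-w45b-strat-1 census v3 §2):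
in a Noetherian local `R` of dimension `4`, for a prime `P` with `R ⧸ P` of dimension `2`, non-regular, with ANISOTROPIC tangent cone,
every «fat» centre ideal `(a, b)` (`R ⧸ (a, b)` regular of dimension `2`) with `ϖ ∈ P ≤ √(a, b, ϖ)` has PRINCIPAL trace in `R ⧸ P`.
T-TRACE-ISO / T-USEFUL-TOUCH-NP (res-L1-w45b-lead-1 p518228 / p520241): a touch that FINISHES the resolution over `x` has
NON-principal trace. This file joins them AT THE SCHEME LEVEL with pointwise hypotheses only (no named facts), and supplies the
dictionary lemmas both sides of the chain keep re-deriving: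

* `isRegularLocalRing_quotient_ker_stalkMap_iff`, `ringKrullDim_quotient_ker_stalkMap` — for a closed immersion `ι : Z → X`,
  `𝒪_{X, ι z} ⧸ ker ι♯_z ≅ 𝒪_{Z, z}` (regularity and dimension read on either side);
* `isPrime_ker_sup_span_singleton_iff`, `mem_sq_sup_ker_iff` — transport of the anisotropy clause along a surjection;
* `exists_pair_span_eq_of_isRegularLocalRing_quotient` — a regular quotient of codimension `2` of a regular local ring is cut out
  by TWO elements (Matsumura 14.2; tree `exists_span_eq_of_isRegularLocalRing_quotient` + `RegularParameters…`);
* `stalkIdeal_vanishingIdeal_le_radical_sup_of_support_inter_subset` — SCHEME E1 ⇒ STALK E1: `supp C ∩ supp D ⊆ S` implies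
  `(𝓘_S)_x ≤ √(C_x + D_x)` at every point (generizations of `x` = primes of `𝒪_{X,x}`, tree `exists_isLocalizationAtPrime_stalk`);
* `not_finishing_of_fatTouch_of_aniso` — THE OBJECT: one E1 step `τ = Bl_C` at a stage `(X₁, σ₁, Y₁)` (closure `Y₁` irreducible,
  not inside `supp C`), `w ∈ V(closure Y₁)` over `x` NOT regular while every point over `x` is regular afterwards; if at
  `x₁ := ι w` the ambient local ring is regular of dimension `4`, `𝒪_{V(closure Y₁), w}` has dimension `2` and an anisotropic tangent
  cone, the centre is regular at `x₁` of codimension `2` (FAT), and stalk-E1 `P ≤ √(C_{x₁} + (ϖ))` holds for some `ϖ ∈ P` — FALSE.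

References: tree `…NatK5BMYFatTouchInert` (p515200), `…NatTraceIso` (p518228), `…NatUsefulTouchNonPrincipal` (p520241),
`Literature…RegularQuotientIdeal`, `…RegularParameterQuotient`, `…RegularCentreLocalCodim`, `…MarkedIdealsLemmas`; Matsumura,
Commutative Ring Theory, Thm. 14.2 [Matsumura1987].
-/

set_option linter.dupNamespace false -- mandated namespace `Summit.<Summit>.<Problem>` of this single-conjunct summit

universe u

open CategoryTheory AlgebraicGeometry TopologicalSpace Topology IsLocalRing
open Literature.AlgebraicGeometry.Resolution
open AlgebraicGeometry.Scheme.IdealSheafData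

namespace Summit.ResolutionOfSingularities.ResolutionOfSingularities.Cruxes.EquisingularLiftNat.Sections

/-! ## Closed immersions: `𝒪_{X, ι z} ⧸ ker ι♯_z ≅ 𝒪_{Z, z}` -/

/-- For a closed immersion `ι : Z → X`, `𝒪_{X, ι z} ⧸ ker ι♯_z` is regular iff `𝒪_{Z,z}` is (the stalk map is surjective).
[folklore] -/
theorem isRegularLocalRing_quotient_ker_stalkMap_iff {Z X : Scheme.{u}} (ι : Z ⟶ X) [IsClosedImmersion ι] (z : Z) :
    IsRegularLocalRing (X.presheaf.stalk (ι z) ⧸ RingHom.ker (ι.stalkMap z).hom) ↔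
      IsRegularLocalRing (Z.presheaf.stalk z) :=
  let e := RingHom.quotientKerEquivOfSurjective (ι.stalkMap_surjective z)
  ⟨fun _ => IsRegularLocalRing.of_ringEquiv e, fun _ => IsRegularLocalRing.of_ringEquiv e.symm⟩

/-- For a closed immersion `ι : Z → X`, `dim (𝒪_{X, ι z} ⧸ ker ι♯_z) = dim 𝒪_{Z,z}`. [folklore] -/
theorem ringKrullDim_quotient_ker_stalkMap {Z X : Scheme.{u}} (ι : Z ⟶ X) [IsClosedImmersion ι] (z : Z) :
    ringKrullDim (X.presheaf.stalk (ι z) ⧸ RingHom.ker (ι.stalkMap z).hom) = ringKrullDim (Z.presheaf.stalk z) :=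
  ringKrullDim_eq_of_ringEquiv (RingHom.quotientKerEquivOfSurjective (ι.stalkMap_surjective z))

/-- The kernel of the stalk map of the inclusion of `V(C)` at a point `c` is the stalk `C_{ι c}` of the ideal sheaf. [folklore] -/
theorem ker_stalkMap_subschemeι_eq_stalkIdeal {X : Scheme.{u}} (C : X.IdealSheafData) (c : ↥C.subscheme) :
    RingHom.ker (C.subschemeι.stalkMap c).hom = stalkIdeal C (C.subschemeι c) := by
  rw [← stalkIdeal_ker_eq_ker_stalkMap, Scheme.IdealSheafData.ker_subschemeι]

/-- **Reading the FAT hypotheses on the centre.** If `V(C)` is regular and `x₁ ∈ supp C`, then `𝒪_{X,x₁} ⧸ C_{x₁}` is a regular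
local ring, of dimension `dim 𝒪_{V(C), c}` for the point `c` of `V(C)` over `x₁`. [folklore] -/
theorem isRegularLocalRing_quotient_stalkIdeal_of_isRegular {X : Scheme.{u}} (C : X.IdealSheafData)
    (hC : Literature.AlgebraicGeometry.Resolution.Scheme.IsRegular C.subscheme) {x₁ : X} (hx : x₁ ∈ C.support) :
    IsRegularLocalRing (X.presheaf.stalk x₁ ⧸ stalkIdeal C x₁) ∧
      ∃ c : ↥C.subscheme, C.subschemeι c = x₁ ∧
        ringKrullDim (X.presheaf.stalk x₁ ⧸ stalkIdeal C x₁) = ringKrullDim (C.subscheme.presheaf.stalk c) := by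
  have hx' : x₁ ∈ Set.range C.subschemeι := by rw [Scheme.IdealSheafData.range_subschemeι]; exact hx
  obtain ⟨c, rfl⟩ := hx'
  rw [← ker_stalkMap_subschemeι_eq_stalkIdeal]
  exact ⟨(isRegularLocalRing_quotient_ker_stalkMap_iff C.subschemeι c).mpr (hC c), c, rfl,
    ringKrullDim_quotient_ker_stalkMap C.subschemeι c⟩

/-! ## Transport of the anisotropy clause along a surjection -/

/-- For a surjection `φ : R → S`: `ker φ + (x)` is prime iff `(φ x)` is prime. [folklore] -/
theorem isPrime_ker_sup_span_singleton_iff {R S : Type*} [CommRing R] [CommRing S] (φ : R →+* S)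
    (hφ : Function.Surjective φ) (x : R) :
    (RingHom.ker φ ⊔ Ideal.span {x}).IsPrime ↔ (Ideal.span {φ x}).IsPrime := by
  have hmap : (RingHom.ker φ ⊔ Ideal.span {x}).map φ = Ideal.span {φ x} := by
    rw [Ideal.map_sup, Ideal.map_span, Set.image_singleton, (Ideal.map_eq_bot_iff_le_ker φ).mpr le_rfl,
      bot_sup_eq]
  have hcomap : (Ideal.span {φ x}).comap φ = RingHom.ker φ ⊔ Ideal.span {x} := by
    rw [← hmap, Ideal.comap_map_of_surjective _ hφ, ← RingHom.ker_eq_comap_bot, sup_comm (RingHom.ker φ ⊔ _),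
      ← sup_assoc, sup_idem, sup_comm]
  constructor
  · intro h
    rw [← hmap]
    exact Ideal.map_isPrime_of_surjective hφ le_sup_left
  · intro h
    rw [← hcomap]
    exact Ideal.comap_isPrime φ _

/-- For a surjection `φ : R → S` of local rings: `x ∈ 𝔪_R² + ker φ` iff `φ x ∈ 𝔪_S²`. [folklore] -/
theorem mem_sq_sup_ker_iff {R S : Type*} [CommRing R] [CommRing S] [IsLocalRing R] [IsLocalRing S]
    (φ : R →+* S) (hφ : Function.Surjective φ) (x : R) :
    x ∈ (maximalIdeal R) ^ 2 ⊔ RingHom.ker φ ↔ φ x ∈ (maximalIdeal S) ^ 2 := by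
  have hm : (maximalIdeal R).map φ = maximalIdeal S := IsLocalRing.map_maximalIdeal_of_surjective φ hφ
  rw [← hm, ← Ideal.map_pow, ← Ideal.mem_comap, Ideal.comap_map_of_surjective _ hφ, ← RingHom.ker_eq_comap_bot]

/-! ## A regular quotient of codimension two is cut out by two elements -/

/-- **Regular modulo regular of codimension `2` is a complete intersection of two elements** (Matsumura 14.2): if `R` is a
regular local ring and `J ⊆ 𝔪` an ideal with `R ⧸ J` regular and `dim R ⧸ J + 2 = dim R`, then `J = (a, b)` for some
`a, b ∈ 𝔪`. [cite: Matsumura1987, Thm. 14.2] -/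
theorem exists_pair_span_eq_of_isRegularLocalRing_quotient {R : Type u} [CommRing R] [IsRegularLocalRing R]
    {J : Ideal R} [IsRegularLocalRing (R ⧸ J)] (hJ : J ≤ maximalIdeal R)
    (hdim : ringKrullDim (R ⧸ J) + 2 = ringKrullDim R) :
    ∃ a b : R, a ∈ maximalIdeal R ∧ b ∈ maximalIdeal R ∧ J = Ideal.span {a, b} := by
  obtain ⟨c, f, hfG, hspan, hli⟩ :=
    exists_span_eq_of_isRegularLocalRing_quotient hJ (J : Set R) (Ideal.span_eq J)
  have hf : ∀ i, f i ∈ maximalIdeal R := fun i => hJ (hfG i)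
  have hind := forall_mem_maximalIdeal_of_linearIndependent_toCotangent f hf hli
  have hq := (RegularParameters.isRegularLocalRing_quotient_span_range f hf hind).2
  rw [hspan] at hq
  -- `dim R ⧸ J` is finite
  obtain ⟨m, hm⟩ : ∃ m : ℕ, ringKrullDim (R ⧸ J) = m := by
    have h1 := IsLocalRing.maximalIdeal_height_eq_ringKrullDim (R := R ⧸ J)
    have h2 : (maximalIdeal (R ⧸ J)).height ≠ ⊤ := (maximalIdeal (R ⧸ J)).height_ne_top Ideal.IsPrime.ne_top'
    obtain ⟨m, hm⟩ := ENat.ne_top_iff_exists.mp h2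
    exact ⟨m, by rw [← h1, ← hm]; rfl⟩
  rw [hm] at hq hdim
  rw [← hdim] at hq
  have hc : c = 2 := by
    have h' : ((m + c : ℕ) : WithBot ℕ∞) = ((m + 2 : ℕ) : WithBot ℕ∞) := by
      push_cast
      exact hq
    have := WithBot.coe_inj.mp h'
    have := ENat.coe_inj.mp this
    omega
  subst hc
  refine ⟨f 0, f 1, hf 0, hf 1, ?_⟩
  rw [← hspan]
  congr 1
  ext r
  simp only [Set.mem_range, Set.mem_insert_iff, Set.mem_singleton_iff, Fin.exists_fin_two]
  tauto

/-! ## SCHEME E1 ⇒ STALK E1 -/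

/-- **Support inclusions are read on stalks along generizations.** For ideal sheaves `C, D` on `X` and a closed `S ⊆ X` with
`supp C ∩ supp D ⊆ S`, at every point `x` one has `(𝓘_S)_x ≤ √(C_x + D_x)` in `𝒪_{X,x}`: a prime `𝔮 ⊇ C_x + D_x` of `𝒪_{X,x}` is
the maximal ideal of `𝒪_{X,y} = (𝒪_{X,x})_𝔮` for a generization `y` of `x` (tree `exists_isLocalizationAtPrime_stalk`), which then
lies in `supp C ∩ supp D ⊆ S = supp 𝓘_S`, so `(𝓘_S)_x ⊆ 𝔮`. (E1 in scheme form `supp C ∩ F ⊆ Y₁` ⇒ the ring-level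
`P ≤ √(C_x + (ϖ))` used by `…AnisoInertia`.) [folklore] -/
theorem stalkIdeal_vanishingIdeal_le_radical_sup_of_support_inter_subset {X : Scheme.{u}} (C D : X.IdealSheafData)
    (S : Closeds X) (h : (C.support : Set X) ∩ (D.support : Set X) ⊆ S) (x : X) :
    stalkIdeal (vanishingIdeal S) x ≤ (stalkIdeal C x ⊔ stalkIdeal D x).radical := by
  rw [Ideal.radical_eq_sInf]
  refine le_sInf ?_
  rintro 𝔮 ⟨hle, h𝔮⟩
  haveI := h𝔮
  obtain ⟨y, φ, hloc, hst⟩ := exists_isLocalizationAtPrime_stalk x 𝔮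
  letI := φ.toAlgebra
  haveI := hloc
  have hφ : φ = algebraMap (X.presheaf.stalk x) (X.presheaf.stalk y) := rfl
  have hmap : 𝔮.map φ = maximalIdeal (X.presheaf.stalk y) := by
    rw [hφ]; exact IsLocalization.AtPrime.map_eq_maximalIdeal 𝔮 (X.presheaf.stalk y)
  have hsub : ∀ I : X.IdealSheafData, stalkIdeal I x ≤ 𝔮 → y ∈ I.support := by
    intro I hI
    rw [mem_support_iff_stalkIdeal_le, hst I, ← hmap]
    exact Ideal.map_mono hI
  have hyS : y ∈ (S : Set X) := h ⟨hsub C (le_sup_left.trans hle), hsub D (le_sup_right.trans hle)⟩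
  have hle' : stalkIdeal (vanishingIdeal S) y ≤ maximalIdeal _ := by
    rw [← mem_support_iff_stalkIdeal_le, ← SetLike.mem_coe, coe_support_vanishingIdeal]
    exact hyS
  rw [hst] at hle'
  intro s hs
  have h1 : φ s ∈ maximalIdeal _ := hle' (Ideal.mem_map_of_mem φ hs)
  exact (IsLocalization.AtPrime.to_map_mem_maximal_iff (X.presheaf.stalk y) 𝔮 s).mp h1

/-! ## THE OBJECT: a fat touch at an anisotropic point never finishes -/

/-- **[OURS · L1 W4.5(b)] T-FAT-NOT-FINISHING.** One E1 step `τ : X₂ = Bl_C X₁ → X₁` (`X₁` locally Noetherian) at a stage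
`(X₁, σ₁, Y₁)` with `closure Y₁` irreducible and not inside `supp C`; `w` a point of `Z₁ := V(closure Y₁)` over `x` whose local
ring is NOT regular, while after the step every point of `V(closure (closure τ⁻¹(Y₁ ∖ supp C)))` over `x` is regular (the
FINISHING touch of T-USEFUL-TOUCH, p513560/p520241). Pointwise data at `x₁ := ι w`, `R := 𝒪_{X₁, x₁}`, `P := ker (R → 𝒪_{Z₁,w})`:
`R` regular of dimension `4`; `𝒪_{Z₁,w}` of dimension `2` with ANISOTROPIC tangent cone (clause (a): `(x̄)` is prime for every
`x̄ ∈ 𝔪_w ∖ 𝔪_w²`); the centre FAT at `x₁`: `R ⧸ C_{x₁}` regular of dimension `2`; and stalk-E1 `P ≤ √(C_{x₁} + (ϖ))` for some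
`ϖ ∈ P` (from the scheme E1 clause by `stalkIdeal_vanishingIdeal_le_radical_sup_of_support_inter_subset`). CONCLUSION: `False` —
by `…AnisoInertia.exists_map_span_pair_eq_span_singleton` (p515200) the trace is principal, by `not_isPrincipal_trace_of_usefulTouch`
(p518228) it is not. So at an anisotropic point of a `2`-dimensional stratum in a `4`-dimensional regular ambient (the K5-BMY
situation at `η_S`, `n = 5`), the finishing touch has relative dimension `≤ 2`. [folklore] -/
theorem not_finishing_of_fatTouch_of_aniso {X₁ X₂ P : AlgebraicGeometry.Scheme.{0}} [AlgebraicGeometry.IsLocallyNoetherian X₁]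
    (σ₁ : X₁ ⟶ P) (x : P) (Y₁ : Set X₁) (C : X₁.IdealSheafData) (τ : X₂ ⟶ X₁)
    (hτ : Literature.AlgebraicGeometry.Resolution.IsBlowup τ C)
    (hirr : IsIrreducible (closure Y₁)) (hYC : ¬ closure Y₁ ⊆ (C.support : Set X₁))
    (w : ↥(AlgebraicGeometry.Scheme.IdealSheafData.vanishingIdeal (⟨closure Y₁, isClosed_closure⟩ : TopologicalSpace.Closeds X₁)).subscheme)
    (hwx : σ₁ ((AlgebraicGeometry.Scheme.IdealSheafData.vanishingIdeal (⟨closure Y₁, isClosed_closure⟩ : TopologicalSpace.Closeds X₁)).subschemeι w) = x)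
    (hw : ¬ IsRegularLocalRing ((AlgebraicGeometry.Scheme.IdealSheafData.vanishingIdeal (⟨closure Y₁, isClosed_closure⟩ : TopologicalSpace.Closeds X₁)).subscheme.presheaf.stalk w))
    (hall : ∀ w' : ↥(AlgebraicGeometry.Scheme.IdealSheafData.vanishingIdeal (⟨closure (closure (τ ⁻¹' (Y₁ \ (C.support : Set X₁)))), isClosed_closure⟩ : TopologicalSpace.Closeds X₂)).subscheme, (CategoryTheory.CategoryStruct.comp τ σ₁) ((AlgebraicGeometry.Scheme.IdealSheafData.vanishingIdeal (⟨closure (closure (τ ⁻¹' (Y₁ \ (C.support : Set X₁)))), isClosed_closure⟩ : TopologicalSpace.Closeds X₂)).subschemeι w') = x → IsRegularLocalRing ((AlgebraicGeometry.Scheme.IdealSheafData.vanishingIdeal (⟨closure (closure (τ ⁻¹' (Y₁ \ (C.support : Set X₁)))), isClosed_closure⟩ : TopologicalSpace.Closeds X₂)).subscheme.presheaf.stalk w'))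
    -- pointwise data at `x₁ := ι w`
    (hR : IsRegularLocalRing (X₁.presheaf.stalk ((AlgebraicGeometry.Scheme.IdealSheafData.vanishingIdeal (⟨closure Y₁, isClosed_closure⟩ : TopologicalSpace.Closeds X₁)).subschemeι w)))
    (hR4 : ringKrullDim (X₁.presheaf.stalk ((AlgebraicGeometry.Scheme.IdealSheafData.vanishingIdeal (⟨closure Y₁, isClosed_closure⟩ : TopologicalSpace.Closeds X₁)).subschemeι w)) = 4)
    (hZ2 : ringKrullDim ((AlgebraicGeometry.Scheme.IdealSheafData.vanishingIdeal (⟨closure Y₁, isClosed_closure⟩ : TopologicalSpace.Closeds X₁)).subscheme.presheaf.stalk w) = 2)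
    (hAniso : ∀ s : (AlgebraicGeometry.Scheme.IdealSheafData.vanishingIdeal (⟨closure Y₁, isClosed_closure⟩ : TopologicalSpace.Closeds X₁)).subscheme.presheaf.stalk w,
      s ∈ IsLocalRing.maximalIdeal _ → s ∉ (IsLocalRing.maximalIdeal _) ^ 2 → (Ideal.span {s}).IsPrime)
    (hCreg : IsRegularLocalRing (X₁.presheaf.stalk ((AlgebraicGeometry.Scheme.IdealSheafData.vanishingIdeal (⟨closure Y₁, isClosed_closure⟩ : TopologicalSpace.Closeds X₁)).subschemeι w) ⧸
      stalkIdeal C ((AlgebraicGeometry.Scheme.IdealSheafData.vanishingIdeal (⟨closure Y₁, isClosed_closure⟩ : TopologicalSpace.Closeds X₁)).subschemeι w)))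
    (hC2 : ringKrullDim (X₁.presheaf.stalk ((AlgebraicGeometry.Scheme.IdealSheafData.vanishingIdeal (⟨closure Y₁, isClosed_closure⟩ : TopologicalSpace.Closeds X₁)).subschemeι w) ⧸
      stalkIdeal C ((AlgebraicGeometry.Scheme.IdealSheafData.vanishingIdeal (⟨closure Y₁, isClosed_closure⟩ : TopologicalSpace.Closeds X₁)).subschemeι w)) = 2)
    (ϖ : X₁.presheaf.stalk ((AlgebraicGeometry.Scheme.IdealSheafData.vanishingIdeal (⟨closure Y₁, isClosed_closure⟩ : TopologicalSpace.Closeds X₁)).subschemeι w))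
    (hϖ : ϖ ∈ RingHom.ker ((AlgebraicGeometry.Scheme.IdealSheafData.vanishingIdeal (⟨closure Y₁, isClosed_closure⟩ : TopologicalSpace.Closeds X₁)).subschemeι.stalkMap w).hom)
    (hE1 : RingHom.ker ((AlgebraicGeometry.Scheme.IdealSheafData.vanishingIdeal (⟨closure Y₁, isClosed_closure⟩ : TopologicalSpace.Closeds X₁)).subschemeι.stalkMap w).hom ≤
      (stalkIdeal C ((AlgebraicGeometry.Scheme.IdealSheafData.vanishingIdeal (⟨closure Y₁, isClosed_closure⟩ : TopologicalSpace.Closeds X₁)).subschemeι w) ⊔ Ideal.span {ϖ}).radical) :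
    False := by
  haveI : IsIntegral (AlgebraicGeometry.Scheme.IdealSheafData.vanishingIdeal (⟨closure Y₁, isClosed_closure⟩ : TopologicalSpace.Closeds X₁)).subscheme :=
    ComponentGluing.isIntegral_subscheme_vanishingIdeal ⟨closure Y₁, isClosed_closure⟩ hirr
  have hsurj : Function.Surjective ((AlgebraicGeometry.Scheme.IdealSheafData.vanishingIdeal (⟨closure Y₁, isClosed_closure⟩ : TopologicalSpace.Closeds X₁)).subschemeι.stalkMap w).hom := (AlgebraicGeometry.Scheme.IdealSheafData.vanishingIdeal (⟨closure Y₁, isClosed_closure⟩ : TopologicalSpace.Closeds X₁)).subschemeι.stalkMap_surjective w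
  haveI hPk : (RingHom.ker ((AlgebraicGeometry.Scheme.IdealSheafData.vanishingIdeal (⟨closure Y₁, isClosed_closure⟩ : TopologicalSpace.Closeds X₁)).subschemeι.stalkMap w).hom).IsPrime := RingHom.ker_isPrime _
  haveI : IsRegularLocalRing (X₁.presheaf.stalk ((AlgebraicGeometry.Scheme.IdealSheafData.vanishingIdeal (⟨closure Y₁, isClosed_closure⟩ : TopologicalSpace.Closeds X₁)).subschemeι w)) := hR
  -- the quotient `R ⧸ P ≅ 𝒪_{Z₁, w}`: dimension 2, not regular
  have hP2 : ringKrullDim (X₁.presheaf.stalk ((AlgebraicGeometry.Scheme.IdealSheafData.vanishingIdeal (⟨closure Y₁, isClosed_closure⟩ : TopologicalSpace.Closeds X₁)).subschemeι w) ⧸ RingHom.ker ((AlgebraicGeometry.Scheme.IdealSheafData.vanishingIdeal (⟨closure Y₁, isClosed_closure⟩ : TopologicalSpace.Closeds X₁)).subschemeι.stalkMap w).hom) = 2 :=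
    (ringKrullDim_quotient_ker_stalkMap (AlgebraicGeometry.Scheme.IdealSheafData.vanishingIdeal (⟨closure Y₁, isClosed_closure⟩ : TopologicalSpace.Closeds X₁)).subschemeι w).trans hZ2
  have hPA : ¬ IsRegularLocalRing (X₁.presheaf.stalk ((AlgebraicGeometry.Scheme.IdealSheafData.vanishingIdeal (⟨closure Y₁, isClosed_closure⟩ : TopologicalSpace.Closeds X₁)).subschemeι w) ⧸ RingHom.ker ((AlgebraicGeometry.Scheme.IdealSheafData.vanishingIdeal (⟨closure Y₁, isClosed_closure⟩ : TopologicalSpace.Closeds X₁)).subschemeι.stalkMap w).hom) :=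
    fun h => hw ((isRegularLocalRing_quotient_ker_stalkMap_iff (AlgebraicGeometry.Scheme.IdealSheafData.vanishingIdeal (⟨closure Y₁, isClosed_closure⟩ : TopologicalSpace.Closeds X₁)).subschemeι w).mp h)
  -- anisotropy transported to `R`
  have hAnisoR : ∀ r : X₁.presheaf.stalk ((AlgebraicGeometry.Scheme.IdealSheafData.vanishingIdeal (⟨closure Y₁, isClosed_closure⟩ : TopologicalSpace.Closeds X₁)).subschemeι w), r ∈ maximalIdeal _ →
      r ∉ (maximalIdeal _) ^ 2 ⊔ RingHom.ker ((AlgebraicGeometry.Scheme.IdealSheafData.vanishingIdeal (⟨closure Y₁, isClosed_closure⟩ : TopologicalSpace.Closeds X₁)).subschemeι.stalkMap w).hom →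
      (RingHom.ker ((AlgebraicGeometry.Scheme.IdealSheafData.vanishingIdeal (⟨closure Y₁, isClosed_closure⟩ : TopologicalSpace.Closeds X₁)).subschemeι.stalkMap w).hom ⊔ Ideal.span {r}).IsPrime := by
    intro r hr hr2
    rw [isPrime_ker_sup_span_singleton_iff _ hsurj r]
    refine hAniso _ ?_ ?_
    · have hm := IsLocalRing.map_maximalIdeal_of_surjective ((AlgebraicGeometry.Scheme.IdealSheafData.vanishingIdeal (⟨closure Y₁, isClosed_closure⟩ : TopologicalSpace.Closeds X₁)).subschemeι.stalkMap w).hom hsurj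
      rw [← hm]; exact Ideal.mem_map_of_mem _ hr
    · rwa [← mem_sq_sup_ker_iff _ hsurj r]
  -- the centre is cut out by two elements
  haveI : IsRegularLocalRing (X₁.presheaf.stalk ((AlgebraicGeometry.Scheme.IdealSheafData.vanishingIdeal (⟨closure Y₁, isClosed_closure⟩ : TopologicalSpace.Closeds X₁)).subschemeι w) ⧸ stalkIdeal C ((AlgebraicGeometry.Scheme.IdealSheafData.vanishingIdeal (⟨closure Y₁, isClosed_closure⟩ : TopologicalSpace.Closeds X₁)).subschemeι w)) := hCreg
  have hJne : stalkIdeal C ((AlgebraicGeometry.Scheme.IdealSheafData.vanishingIdeal (⟨closure Y₁, isClosed_closure⟩ : TopologicalSpace.Closeds X₁)).subschemeι w) ≠ ⊤ := Ideal.Quotient.nontrivial_iff.mp inferInstance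
  have hJm : stalkIdeal C ((AlgebraicGeometry.Scheme.IdealSheafData.vanishingIdeal (⟨closure Y₁, isClosed_closure⟩ : TopologicalSpace.Closeds X₁)).subschemeι w) ≤ maximalIdeal _ := IsLocalRing.le_maximalIdeal hJne
  obtain ⟨a, b, ha, hb, hJab⟩ := exists_pair_span_eq_of_isRegularLocalRing_quotient hJm (by rw [hC2, hR4]; rfl)
  have hB : IsRegularLocalRing (X₁.presheaf.stalk ((AlgebraicGeometry.Scheme.IdealSheafData.vanishingIdeal (⟨closure Y₁, isClosed_closure⟩ : TopologicalSpace.Closeds X₁)).subschemeι w) ⧸ Ideal.span {a, b}) := by rw [← hJab]; exact hCreg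
  have hdimB : ringKrullDim (X₁.presheaf.stalk ((AlgebraicGeometry.Scheme.IdealSheafData.vanishingIdeal (⟨closure Y₁, isClosed_closure⟩ : TopologicalSpace.Closeds X₁)).subschemeι w) ⧸ Ideal.span {a, b}) = 2 := by rw [← hJab]; exact hC2
  have hE1' : RingHom.ker ((AlgebraicGeometry.Scheme.IdealSheafData.vanishingIdeal (⟨closure Y₁, isClosed_closure⟩ : TopologicalSpace.Closeds X₁)).subschemeι.stalkMap w).hom ≤ (Ideal.span {a, b, ϖ}).radical := by
    have e : Ideal.span {a, b, ϖ} = stalkIdeal C ((AlgebraicGeometry.Scheme.IdealSheafData.vanishingIdeal (⟨closure Y₁, isClosed_closure⟩ : TopologicalSpace.Closeds X₁)).subschemeι w) ⊔ Ideal.span {ϖ} := by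
      rw [hJab]
      simp only [Ideal.span_insert, sup_assoc]
    rw [e]; exact hE1
  -- the trace is principal …
  obtain ⟨c, hc⟩ := AnisoInertia.exists_map_span_pair_eq_span_singleton hR4 hP2 hPA hAnisoR hϖ ha hb hB hdimB hE1'
  have hprin : (stalkIdeal (C.comap (AlgebraicGeometry.Scheme.IdealSheafData.vanishingIdeal (⟨closure Y₁, isClosed_closure⟩ : TopologicalSpace.Closeds X₁)).subschemeι) w).IsPrincipal := by
    refine isPrincipal_stalkIdeal_comap_of_map_mk (AlgebraicGeometry.Scheme.IdealSheafData.vanishingIdeal (⟨closure Y₁, isClosed_closure⟩ : TopologicalSpace.Closeds X₁)).subschemeι C w ⟨c, ?_⟩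
    change Ideal.map _ (stalkIdeal C ((AlgebraicGeometry.Scheme.IdealSheafData.vanishingIdeal (⟨closure Y₁, isClosed_closure⟩ : TopologicalSpace.Closeds X₁)).subschemeι w)) = _
    rw [hJab]
    exact hc
  -- … and it is not
  exact not_isPrincipal_trace_of_usefulTouch σ₁ x Y₁ C τ hτ hirr hYC w hwx hw hall hprin

/-- **T-FAT-NOT-FINISHING, scheme-E1 form.** As `not_finishing_of_fatTouch_of_aniso`, with the E1 hypothesis in SCHEME form:
an ideal sheaf `D` (the special fibre) with `supp C ∩ supp D ⊆ closure Y₁` whose stalk at `x₁` lies in `(ϖ)` for some `ϖ` vanishing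
on `V(closure Y₁)` at `w`; the stalk form `P ≤ √(C_{x₁} + (ϖ))` is derived by
`stalkIdeal_vanishingIdeal_le_radical_sup_of_support_inter_subset`. [folklore] -/
theorem not_finishing_of_fatTouch_of_aniso' {X₁ X₂ P : AlgebraicGeometry.Scheme.{0}} [AlgebraicGeometry.IsLocallyNoetherian X₁]
    (σ₁ : X₁ ⟶ P) (x : P) (Y₁ : Set X₁) (C : X₁.IdealSheafData) (τ : X₂ ⟶ X₁)
    (hτ : Literature.AlgebraicGeometry.Resolution.IsBlowup τ C)
    (hirr : IsIrreducible (closure Y₁)) (hYC : ¬ closure Y₁ ⊆ (C.support : Set X₁))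
    (w : ↥(AlgebraicGeometry.Scheme.IdealSheafData.vanishingIdeal (⟨closure Y₁, isClosed_closure⟩ : TopologicalSpace.Closeds X₁)).subscheme)
    (hwx : σ₁ ((AlgebraicGeometry.Scheme.IdealSheafData.vanishingIdeal (⟨closure Y₁, isClosed_closure⟩ : TopologicalSpace.Closeds X₁)).subschemeι w) = x)
    (hw : ¬ IsRegularLocalRing ((AlgebraicGeometry.Scheme.IdealSheafData.vanishingIdeal (⟨closure Y₁, isClosed_closure⟩ : TopologicalSpace.Closeds X₁)).subscheme.presheaf.stalk w))
    (hall : ∀ w' : ↥(AlgebraicGeometry.Scheme.IdealSheafData.vanishingIdeal (⟨closure (closure (τ ⁻¹' (Y₁ \ (C.support : Set X₁)))), isClosed_closure⟩ : TopologicalSpace.Closeds X₂)).subscheme, (CategoryTheory.CategoryStruct.comp τ σ₁) ((AlgebraicGeometry.Scheme.IdealSheafData.vanishingIdeal (⟨closure (closure (τ ⁻¹' (Y₁ \ (C.support : Set X₁)))), isClosed_closure⟩ : TopologicalSpace.Closeds X₂)).subschemeι w') = x → IsRegularLocalRing ((AlgebraicGeometry.Scheme.IdealSheafData.vanishingIdeal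 (⟨closure (closure (τ ⁻¹' (Y₁ \ (C.support : Set X₁)))), isClosed_closure⟩ : TopologicalSpace.Closeds X₂)).subscheme.presheaf.stalk w'))
    (hR : IsRegularLocalRing (X₁.presheaf.stalk ((AlgebraicGeometry.Scheme.IdealSheafData.vanishingIdeal (⟨closure Y₁, isClosed_closure⟩ : TopologicalSpace.Closeds X₁)).subschemeι w)))
    (hR4 : ringKrullDim (X₁.presheaf.stalk ((AlgebraicGeometry.Scheme.IdealSheafData.vanishingIdeal (⟨closure Y₁, isClosed_closure⟩ : TopologicalSpace.Closeds X₁)).subschemeι w)) = 4)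
    (hZ2 : ringKrullDim ((AlgebraicGeometry.Scheme.IdealSheafData.vanishingIdeal (⟨closure Y₁, isClosed_closure⟩ : TopologicalSpace.Closeds X₁)).subscheme.presheaf.stalk w) = 2)
    (hAniso : ∀ s : (AlgebraicGeometry.Scheme.IdealSheafData.vanishingIdeal (⟨closure Y₁, isClosed_closure⟩ : TopologicalSpace.Closeds X₁)).subscheme.presheaf.stalk w,
      s ∈ IsLocalRing.maximalIdeal _ → s ∉ (IsLocalRing.maximalIdeal _) ^ 2 → (Ideal.span {s}).IsPrime)
    (hCreg : IsRegularLocalRing (X₁.presheaf.stalk ((AlgebraicGeometry.Scheme.IdealSheafData.vanishingIdeal (⟨closure Y₁, isClosed_closure⟩ : TopologicalSpace.Closeds X₁)).subschemeι w) ⧸ stalkIdeal C ((AlgebraicGeometry.Scheme.IdealSheafData.vanishingIdeal (⟨closure Y₁, isClosed_closure⟩ : TopologicalSpace.Closeds X₁)).subschemeι w)))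
    (hC2 : ringKrullDim (X₁.presheaf.stalk ((AlgebraicGeometry.Scheme.IdealSheafData.vanishingIdeal (⟨closure Y₁, isClosed_closure⟩ : TopologicalSpace.Closeds X₁)).subschemeι w) ⧸ stalkIdeal C ((AlgebraicGeometry.Scheme.IdealSheafData.vanishingIdeal (⟨closure Y₁, isClosed_closure⟩ : TopologicalSpace.Closeds X₁)).subschemeι w)) = 2)
    (D : X₁.IdealSheafData) (hE1 : (C.support : Set X₁) ∩ (D.support : Set X₁) ⊆ closure Y₁)
    (ϖ : X₁.presheaf.stalk ((AlgebraicGeometry.Scheme.IdealSheafData.vanishingIdeal (⟨closure Y₁, isClosed_closure⟩ : TopologicalSpace.Closeds X₁)).subschemeι w)) (hD : stalkIdeal D ((AlgebraicGeometry.Scheme.IdealSheafData.vanishingIdeal (⟨closure Y₁, isClosed_closure⟩ : TopologicalSpace.Closeds X₁)).subschemeι w) ≤ Ideal.span {ϖ})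
    (hϖ : ϖ ∈ stalkIdeal (AlgebraicGeometry.Scheme.IdealSheafData.vanishingIdeal (⟨closure Y₁, isClosed_closure⟩ : TopologicalSpace.Closeds X₁)) ((AlgebraicGeometry.Scheme.IdealSheafData.vanishingIdeal (⟨closure Y₁, isClosed_closure⟩ : TopologicalSpace.Closeds X₁)).subschemeι w)) :
    False := by
  have hker : RingHom.ker ((AlgebraicGeometry.Scheme.IdealSheafData.vanishingIdeal (⟨closure Y₁, isClosed_closure⟩ : TopologicalSpace.Closeds X₁)).subschemeι.stalkMap w).hom =
      stalkIdeal (AlgebraicGeometry.Scheme.IdealSheafData.vanishingIdeal (⟨closure Y₁, isClosed_closure⟩ : TopologicalSpace.Closeds X₁)) ((AlgebraicGeometry.Scheme.IdealSheafData.vanishingIdeal (⟨closure Y₁, isClosed_closure⟩ : TopologicalSpace.Closeds X₁)).subschemeι w) :=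
    ker_stalkMap_subschemeι_eq_stalkIdeal _ w
  refine not_finishing_of_fatTouch_of_aniso σ₁ x Y₁ C τ hτ hirr hYC w hwx hw hall hR hR4 hZ2 hAniso hCreg hC2 ϖ (hker ▸ hϖ) ?_
  rw [hker]
  refine (stalkIdeal_vanishingIdeal_le_radical_sup_of_support_inter_subset C D ⟨closure Y₁, isClosed_closure⟩ hE1 _).trans ?_
  exact Ideal.radical_mono (sup_le_sup_left hD _)

end Summit.ResolutionOfSingularities.ResolutionOfSingularities.Cruxes.EquisingularLiftNat.Sections
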